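import Literature.GroupTheory.CombinatorialGroupTheory.TreeContractionFaces
import Literature.GroupTheory.CombinatorialGroupTheory.PresentedGroupKillGenerators
import Literature.GroupTheory.CombinatorialGroupTheory.QuadraticSystemsGluingIterate
import Literature.GroupTheory.CombinatorialGroupTheory.QuadraticWordsOneVertexSurfaceGroups
import Literature.GroupTheory.CombinatorialGroupTheory.QuadraticWordsVerticesBridge
import Literature.GroupTheory.CombinatorialGroupTheory.QuadraticWordsVertexCalculus
import Literature.GroupTheory.CombinatorialGroupTheory.SurfaceGroupConjugacySeparable
import Literature.Topology.FourManifolds.SurfaceGroupEpimorphismsProofs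
import HarnessLib

/-!
# Finite-index subgroups of surface groups are surface groups (Riemann–Hurwitz / ZVC 4.14.22)

Topic `Literature/GroupTheory/CombinatorialGroupTheory`.  This file DISCHARGES the named fact
`SurfaceGroupFiniteIndexSubgroup` of `SurfaceGroupConjugacySeparable.lean`: for `g ≥ 2`, a
subgroup `K` of finite index `j` in the orientable surface group
`S_g = ⟨a₁, b₁, …, a_g, b_g ∣ ∏ [aᵢ, bᵢ]⟩` is isomorphic to the surface group `S_h`,
`h = j (g - 1) + 1` (Zieschang–Vogt–Coldewey, LNM 835, Thm 4.14.22 / Prop 4.14.23).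

The kernel proof follows ZVC's (Reidemeister–Schreier + Euler characteristic), entirely
combinatorially:
1. `subgroupEquivCoveringPresentation` (`ReidemeisterSchreierCovering.lean`): `K` is presented on
   the edges `X × (S_g ⧸ K)` of its coset graph by the `j` lifted relators (`liftAt`) and the `j - 1`
   edges of the breadth-first Schreier tree (`SchreierTreeBFS.lean`);
2. `sameCycle_contracted`, `contractedFace_ne_nil` (`TreeContractionFaces.lean`): deleting the tree
   letters (allowed: `normalClosure_union_of_eq_normalClosure_killHom`) leaves `j` nonempty faces
   forming a system with ONE vertex;
3. `exists_one_face_of_sysPerm_transitive'` (`QuadraticSystemsGluingIterate.lean`, seat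
   abc-iut-L5-t16): gluing the `j` faces along `j - 1` common edges gives ONE one-vertex word `W`;
4. `nonempty_presentedGroup_kill_equiv`: killing the `2(j-1)` dead symbols leaves the one-relator
   presentation `⟨2gj - 2(j-1) = 2h symbols ∣ W⟩`;
5. `OneVertex.nonempty_presentedGroup_mulEquiv_surfaceGroup_of_card` (seat abc-iut-L5-t16): a
   one-vertex alternating quadratic word on `2h` symbols presents `S_h`.

## References

* H. Zieschang, E. Vogt, H.-D. Coldewey, *Surfaces and Planar Discontinuous Groups*, LNM 835,
  Springer 1980, Thm 4.14.22, Prop 4.14.23 (via 4.14.1, 2.2.1–2.2.4, 3.1.6, 3.2.4).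
  [ZieschangVogtColdewey1980]
-/

namespace Literature.GroupTheory.CombinatorialGroupTheory

open List Equiv Equiv.Perm Literature.Topology.FourManifolds CoveringPresentation

/-! ### The covering data of a finite-index subgroup of a surface group -/

section Setup

variable {g : ℕ} (K : Subgroup (SurfaceGroup g))

/-- The coset action is transitive from the base coset. [cite: ZieschangVogtColdewey1980, 4.14.22] -/
theorem isTransitiveFrom_cosetAct_surface :
    IsTransitiveFrom (cosetAct ({surfaceRelator g} : Set (FreeGroup (surfaceGen g))) K)
      ((1 : SurfaceGroup g) : SurfaceGroup g ⧸ K) := by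
  intro c
  induction c using QuotientGroup.induction_on with
  | H γ =>
    obtain ⟨f, rfl⟩ := PresentedGroup.mk_surjective ({surfaceRelator g} : Set (FreeGroup (surfaceGen g))) γ
    refine ⟨f.toWord, ?_⟩
    rw [FreeGroup.mk_toWord, cosetAct_apply, MulAction.Quotient.smul_coe, smul_eq_mul, mul_one]

/-- The surface relator acts trivially on the cosets. [cite: ZieschangVogtColdewey1980, 4.14.22] -/
theorem cosetAct_surfaceWordStd :
    cosetAct ({surfaceRelator g} : Set (FreeGroup (surfaceGen g))) K (FreeGroup.mk (surfaceWordStd g)) = 1 := by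
  rw [SurfaceGroup.mk_surfaceWordStd]
  exact cosetAct_rel K (Set.mem_singleton _)

/-- The lifted relators of the covering presentation are the lifted faces and the tree edges.
[cite: ZieschangVogtColdewey1980, 4.14.22] -/
theorem liftedRels_eq [Fintype (SurfaceGroup g ⧸ K)] (T : Set (surfaceGen g × (SurfaceGroup g ⧸ K))) :
    liftedRels (cosetAct ({surfaceRelator g} : Set (FreeGroup (surfaceGen g))) K)
        ({surfaceRelator g} : Set (FreeGroup (surfaceGen g))) T =
      (fun F => FreeGroup.mk F) ''
          {F | F ∈ faces (cosetAct ({surfaceRelator g} : Set (FreeGroup (surfaceGen g))) K) (surfaceWordStd g)} ∪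
        FreeGroup.of '' T := by
  ext w
  simp only [liftedRels, Set.mem_union, Set.mem_setOf_eq, Set.mem_singleton_iff, Set.mem_image,
    exists_eq_left]
  apply or_congr_left
  constructor
  · rintro ⟨b, rfl⟩
    refine ⟨liftAt _ (surfaceWordStd g) b, (mem_faces _).2 ⟨b, rfl⟩, ?_⟩
    rw [mk_liftAt, SurfaceGroup.mk_surfaceWordStd]
  · rintro ⟨F, hF, rfl⟩
    obtain ⟨b, rfl⟩ := (mem_faces _).1 hF
    exact ⟨b, by rw [mk_liftAt, SurfaceGroup.mk_surfaceWordStd]⟩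

end Setup

/-! ### The main theorem -/

/-- `2 ≤ |surfaceWordStd g|` for `g ≥ 1`. [folklore] -/
private theorem two_le_length_surfaceWordStd {g : ℕ} (hg : 1 ≤ g) : 2 ≤ (surfaceWordStd g).length := by
  rw [length_surfaceWordStd]; omega

/-- **Finite-index subgroups of orientable surface groups are orientable surface groups, with the
Riemann–Hurwitz genus** (Zieschang–Vogt–Coldewey, LNM 835, Thm 4.14.22 / Prop 4.14.23): the named
fact `SurfaceGroupFiniteIndexSubgroup` holds — for `g ≥ 2` and `K ≤ S_g` of finite index `j`,
`K ≃* S_h` with `h = j (g - 1) + 1`. [cite: ZieschangVogtColdewey1980, Thm 4.14.22 / Prop 4.14.23] -/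
theorem surfaceGroupFiniteIndexSubgroup_holds : SurfaceGroupFiniteIndexSubgroup := by
  intro g hg K hK
  classical
  haveI := hK
  haveI : Fintype (SurfaceGroup g ⧸ K) := by
    first
      | exact Subgroup.fintypeQuotientOfFiniteIndex K
      | exact Subgroup.fintypeQuotientOfFiniteIndex
  -- notation
  set X := surfaceGen g with hX
  set R₀ : List (X × Bool) := surfaceWordStd g with hR₀
  set rels : Set (FreeGroup X) := {surfaceRelator g} with hrels
  let A := SurfaceGroup g ⧸ K
  set act : FreeGroup X →* Equiv.Perm A := cosetAct rels K with hact
  set a₀ : A := ((1 : SurfaceGroup g) : SurfaceGroup g ⧸ K) with ha₀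
  have htr : IsTransitiveFrom act a₀ := isTransitiveFrom_cosetAct_surface K
  have hR : R₀.Nodup := nodup_surfaceWordStd g
  have hall : ∀ β : X × Bool, β ∈ R₀ := mem_surfaceWordStd
  have htriv : act (FreeGroup.mk R₀) = 1 := cosetAct_surfaceWordStd K
  have hV : VertexTransitive R₀ := vertexTransitive_surfaceWordStd g
  have h2 : 2 ≤ R₀.length := two_le_length_surfaceWordStd (by omega)
  -- the index
  set j := K.index with hj
  have hjcard : Fintype.card A = j := by
    rw [hj, Subgroup.index_eq_card, Nat.card_eq_fintype_card]
  have hj1 : 1 ≤ j := Nat.one_le_iff_ne_zero.2 Subgroup.FiniteIndex.index_ne_zero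
  -- (1) Reidemeister–Schreier
  let 𝒯 := bfsTree htr
  have e1 : K ≃* PresentedGroup (liftedRels act rels 𝒯.edges) := subgroupEquivCoveringPresentation K 𝒯
  set T : Set (X × A) := bfsEdges htr with hT
  have hTe : 𝒯.edges = T := rfl
  -- (2) delete the tree letters
  set Fs := contractedFaces htr R₀ with hFs
  have hisTree : ∀ l : (X × A) × Bool, isTree htr l = true ↔ l.1 ∈ T := by
    intro l
    simp only [isTree, IsTreeLetterOf, decide_eq_true_eq, hT, bfsEdges, Set.mem_setOf_eq]
    constructor
    · rintro ⟨p, -, hp⟩; exact ⟨p.1, p.2, hp⟩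
    · rintro ⟨a, ha, h⟩; exact ⟨⟨a, ha⟩, mem_bfsOrder htr _, h⟩
  have hkill : killHom (· ∈ T) '' ((fun F => FreeGroup.mk F) '' {F | F ∈ faces act R₀}) =
      (fun F => FreeGroup.mk F) '' {F | F ∈ Fs} := by
    have hfilt : ∀ F : List ((X × A) × Bool),
        F.filter (fun x => decide ¬ (x.1 ∈ T)) = F.filter (fun l => !isTree htr l) := by
      intro F
      refine filter_congr fun l _ => ?_
      by_cases h : isTree htr l = true
      · have := (hisTree l).1 h; simp [h, this]
      · have : l.1 ∉ T := fun h' => h ((hisTree l).2 h')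
        simp [Bool.eq_false_iff.2 h, this]
    ext w
    simp only [Set.mem_image, Set.mem_setOf_eq, hFs, contractedFaces, mem_map]
    constructor
    · rintro ⟨_, ⟨F, hF, rfl⟩, rfl⟩
      exact ⟨F.filter fun l => !isTree htr l, ⟨F, hF, rfl⟩, by rw [killHom_mk, hfilt]⟩
    · rintro ⟨_, ⟨F, hF, rfl⟩, rfl⟩
      exact ⟨FreeGroup.mk F, ⟨F, hF, rfl⟩, by rw [killHom_mk, hfilt]⟩
  have e2 : PresentedGroup (liftedRels act rels 𝒯.edges) ≃*
      PresentedGroup ((fun F => FreeGroup.mk F) '' {F | F ∈ Fs} ∪ FreeGroup.of '' T) :=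
    QuotientGroup.quotientMulEquivOfEq (by
      rw [hTe, liftedRels_eq K T, normalClosure_union_of_eq_normalClosure_killHom T, hkill])
  -- (3) glue the faces (the contracted system has one vertex)
  have hFs0 : Fs ≠ [] := by
    rw [hFs, contractedFaces, faces, ne_eq, map_eq_nil_iff, map_eq_nil_iff, Finset.toList_eq_nil,
      Finset.univ_eq_empty_iff]
    exact not_isEmpty_of_nonempty A
  have hFslen : Fs.length = j := by
    rw [hFs, contractedFaces, faces, length_map, length_map, Finset.length_toList, Finset.card_univ, hjcard]
  have hdfull : (faces act R₀).flatten.Nodup := nodup_faces_flatten act hR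
  have hFsflat : Fs.flatten = (faces act R₀).flatten.filter fun l => !isTree htr l := by
    rw [hFs, contractedFaces, filter_flatten]
  have hd : Fs.flatten.Nodup := by rw [hFsflat]; exact hdfull.filter _
  have hmemFs : ∀ l : (X × A) × Bool, l ∈ Fs.flatten ↔ isTree htr l = false := by
    intro l
    rw [hFsflat, mem_filter]
    simp [mem_faces_flatten act hR hall l]
  have hc : Closed Fs.flatten := fun l hl => by
    rw [hmemFs] at hl ⊢; rwa [isTree_bar]
  have hne : ∀ F ∈ Fs, F ≠ [] := fun F hF => contractedFace_ne_nil htr hR hall htriv hV h2 hF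
  have ht : ∀ x ∈ Fs.flatten, ∀ z ∈ Fs.flatten, (sysPerm Fs).SameCycle x z := fun x hx z hz =>
    sameCycle_contracted htr hR hall htriv hV ((hmemFs x).1 hx) ((hmemFs z).1 hz)
  obtain ⟨W, D, hWd, hWc, hWV, hWmem, hDocc, hDcard, hiso⟩ :=
    exists_one_face_of_sysPerm_transitive' Fs hFs0 hd hc hne ht
  have hDT : ∀ i ∈ D, i ∉ T := by
    intro i hi hiT
    have h1 := (hmemFs (i, true)).1 (hDocc i hi)
    have h2 := (hisTree (i, true)).2 hiT
    rw [h1] at h2; exact Bool.false_ne_true h2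
  obtain ⟨e3⟩ := hiso (FreeGroup.of '' T) (by
    rintro r ⟨t, ht', rfl⟩ i hi
    rw [FreeGroup.toWord_of]
    intro x hx
    rw [mem_singleton] at hx; subst hx
    exact fun h => hDT i hi (h ▸ ht'))
  -- (4) kill the dead symbols `D ∪ T`
  set S : Set (X × A) := (↑D : Set (X × A)) ∪ T with hS
  have hWS : ∀ x ∈ W, x.1 ∉ S := by
    intro x hx
    obtain ⟨hxF, hxD⟩ := (hWmem x).1 hx
    rintro (h | h)
    · exact hxD h
    · have h1 := (hmemFs x).1 hxF
      rw [(hisTree x).2 h] at h1; exact Bool.false_ne_true h1.symm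
  have hrelsS : ({FreeGroup.mk W} ∪ FreeGroup.of '' (↑D : Set (X × A)) ∪ FreeGroup.of '' T : Set (FreeGroup (X × A))) =
      {FreeGroup.mk W} ∪ FreeGroup.of '' S := by
    rw [hS, Set.image_union, Set.union_assoc]
  have e4a : PresentedGroup ({FreeGroup.mk W} ∪ FreeGroup.of '' (↑D : Set (X × A)) ∪ FreeGroup.of '' T) ≃*
      PresentedGroup ({FreeGroup.mk W} ∪ FreeGroup.of '' S) :=
    QuotientGroup.quotientMulEquivOfEq (by rw [hrelsS])
  set W' := restrictWord S W hWS with hW'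
  obtain ⟨e4⟩ := nonempty_presentedGroup_kill_equiv S W hWS
  -- (5) the one-relator word `W'` is a one-vertex alternating quadratic word on `2h` symbols
  have hd' : W'.Nodup := nodup_restrictWord S hWS hWd
  have hc' : Closed W' := closed_restrictWord S hWS hWc
  have hV' : VertexTransitive W' := vertexTransitive_restrictWord S hWS hWd hWV
  have hOV : OneVertex W' :=
    oneVertex_of_sameCycle hd' (fun x hx => hc' x hx) (vertexPerm W') (fun x _ => rfl) hV'
  have hq' : IsQuadratic W' := IsQuadratic.of_nodup hd' fun x hx => hc' x hx
  have hall' : ∀ i : {i : X × A // i ∉ S}, (i, true) ∈ W' := by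
    intro i
    rw [hW', mem_restrictWord_iff]
    change ((i : X × A), true) ∈ W
    rw [hWmem]
    have hiD : (i : X × A) ∉ D := fun h => i.2 (Or.inl h)
    have hiT : (i : X × A) ∉ T := fun h => i.2 (Or.inr h)
    refine ⟨(hmemFs _).2 ?_, hiD⟩
    by_contra h
    exact hiT ((hisTree _).1 (by simpa using h))
  -- counting: `|X × A| = 2 g j`, `|T| = j - 1 = |D|`, `T ∩ D = ∅`
  set Tfin : Finset (X × A) := Finset.univ.image fun p : NonBase a₀ => arrow htr p.2 with hTfin
  have hTmem : ∀ e, e ∈ Tfin ↔ e ∈ T := by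
    intro e
    simp only [hTfin, Finset.mem_image, Finset.mem_univ, true_and, hT, bfsEdges, Set.mem_setOf_eq]
    constructor
    · rintro ⟨p, hp⟩; exact ⟨p.1, p.2, hp.symm⟩
    · rintro ⟨a, ha, h⟩; exact ⟨⟨a, ha⟩, h.symm⟩
  have hTcard : Tfin.card = j - 1 := by
    rw [hTfin, Finset.card_image_of_injective _ (fun p q h => Subtype.ext (arrow_injective htr p.2 q.2 h)),
      Finset.card_univ]
    have : Fintype.card (NonBase a₀) = Fintype.card A - 1 := by
      show Fintype.card {a : A // a ≠ a₀} = Fintype.card A - 1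
      rw [Fintype.card_subtype_compl, Fintype.card_subtype_eq]
    rw [this, hjcard]
  have hDcard' : D.card = j - 1 := by rw [hFslen] at hDcard; omega
  have hSfin : ∀ e, e ∈ S ↔ e ∈ D ∪ Tfin := by
    intro e; rw [hS, Finset.mem_union, hTmem]; rfl
  have hdisj : Disjoint D Tfin := by
    rw [Finset.disjoint_left]
    intro i hi hiT
    exact hDT i hi ((hTmem i).1 hiT)
  have hcardS : Fintype.card {i : X × A // i ∉ S} = Fintype.card (X × A) - (D ∪ Tfin).card := by
    rw [← Finset.card_compl]
    refine Fintype.card_of_subtype _ fun e => ?_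
    rw [Finset.mem_compl, hSfin]
  have hXc : Fintype.card X = 2 * g := by
    show Fintype.card (surfaceGen g) = 2 * g
    simp [surfaceGen, Fintype.card_prod, Fintype.card_bool, Fintype.card_fin, mul_comm]
  have hcardXA : Fintype.card (X × A) = 2 * g * j := by
    rw [Fintype.card_prod, hXc, hjcard]
  set h : ℕ := j * (g - 1) + 1 with hh
  have hcard : Fintype.card {i : X × A // i ∉ S} = 2 * h := by
    rw [hcardS, Finset.card_union_of_disjoint hdisj, hDcard', hTcard, hcardXA, hh]
    have hg1 : 1 ≤ g := by omega
    have e1' : j * (g - 1) = j * g - j := by rw [Nat.mul_sub_one]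
    have hjg : j ≤ j * g := Nat.le_mul_of_pos_right j (by omega)
    have e2' : 2 * g * j = 2 * (j * g) := by ring
    rw [e1', e2']
    omega
  obtain ⟨e5⟩ := OneVertex.nonempty_presentedGroup_mulEquiv_surfaceGroup_of_card hOV hq' hall' hcard
  exact ⟨h, hh, ⟨e1.trans (e2.trans (e3.trans (e4a.trans (e4.trans e5))))⟩⟩

end Literature.GroupTheory.CombinatorialGroupTheory
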